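import Summits.Ventures.PercRepro.C026Pass

/-!
# C-026 on the M-flip cut tree (mine-3's t66 formulation) and the canonical rule C6′ (p5, gen 7)

mine-3's `proofs/MINE3-Q3-proof.md` re-derives the class lemma of C-026 on the simplest cut tree, the
**M-flip** `δ(S) = S Δ E[Com_c S]` — typer-1's `kSwap c` (GZSwap.lean): Theorem A (bijection, cut
property, the pairing, `ab|c ⊆ BAD`) and the residual claim C6′: after the two tree passes
`τ₅₀ = kSwapSealed c b → ac|b` and `τ₁₈ = kSwapSealed c a → bc|a`, every residual configuration takes its
least free pair-cell superset with one added edge (the `K–M` edges, then the `L–M` edges, then the other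
closed edges, by index), then with two added edges (`e < e'`), in `(|Com_c S|, mask)`-ascending order.

* `BadM` / `BotM` — mine-3's `BAD` / `BAD ∩ bot` on the M-flip; `isCIso_compl_kSwap_iff` (the cut
  property for `c iso`), `conn_kSwap_of_conn_of_not_conn` (`ab|c ⊆ BAD`), **THEOREM A**
  `card_conn_cIso_compl_eq_card_badM` (the pairing), `badM_iff_or`, `card_badM_le_iff`
  (`(CF) ⟺ (CF′)`: `#BadM ≤ #OnePair ⟺ #BotM ≤ #(ac|b) + #(bc|a)`),
  `cubeSumQuad_kernel26_nonneg_iff_M` (the class sum of `kernel26` is nonnegative iff `(CF′)`);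
* `c6Cand1` / `c6Cand2` — the candidate orders of C6″ for an edge list `es` (the index order: the closed
  edges by index; the pairs of closed edges by mask, `pairsByMask`); **`c6Passes`** — mine-3's request
  list; **`C6Complete`** — C6″ as an instance of `SchemeComplete` (any enumeration of `BotM`; mine-3's
  mask order is one witness); `card_botM_le_of_c6Complete`;
* **`C026UpTo_of_c6Complete`** — C-026 on every multigraph with ≤ N vertices, at every `p`, from the
  completeness of C6″ on the simple graphs with ≤ N vertices and three distinct marks;
* **`DFreeIneq`** — mine-3's D-free inequality `#KL′ ≤ #Kc′ + #Lc′` in the `τ`-form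
  `#{bot : a ~ b in δ(S)} ≤ #{bot : τ₅₀(S) ∈ ac|b} + #{bot : τ₁₈(S) ∈ bc|a}` (by mine-3's Theorem B the
  three events are `K ~_H L`, `c ~_H K` in `H − L`, `c ~_H L` in `H − K` in the H-graph of `S`);
  **`card_botM_le_of_dFree`** (the two sealed swaps are injective, so the right side is at most
  `#(ac|b) + #(bc|a)`) and **`C026UpTo_of_dFree`**.
-/

namespace PercRepro

open Finset

namespace MultiGraph

section MFlip

variable {V E : Type*} (G : MultiGraph V E)

/-- **mine-3's `BAD` on the M-flip**: `c` isolated in `S`, and `a ~ b` in `δ(S) = S Δ E[Com_c S]`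
(typer-1's `kSwap c`). -/
def BadM (ω : Config E) (a b c : V) : Prop := G.IsCIso ω a b c ∧ G.Conn (G.kSwap c ω) a b

/-- **The residual `BAD ∩ bot`** on the M-flip: all three marks separate in `S`, and `a ~ b` in `δ(S)`. -/
def BotM (ω : Config E) (a b c : V) : Prop := G.IsBot ω a b c ∧ G.Conn (G.kSwap c ω) a b

/-- **The cut property** (Theorem A (ii)): `c` is isolated in the partner `δ(S)ᶜ` iff it is in `S`. -/
theorem isCIso_compl_kSwap_iff (a b c : V) (ω : Config E) :
    G.IsCIso (G.kSwap c ω)ᶜ a b c ↔ G.IsCIso ω a b c := by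
  unfold IsCIso
  rw [G.conn_comm (u := a), G.conn_comm (u := b), G.conn_compl_kSwap_iff, G.conn_compl_kSwap_iff,
    G.conn_comm (u := c) (v := a), G.conn_comm (u := c) (v := b)]

/-- An `ω`-open edge at the cluster of `a` is not at the cluster of `c` when `a ≁ c`. -/
theorem not_mem_edgesAt_cluster_of_open_edgesAt {a c : V} {ω : Config E} (hac : ¬ G.Conn ω a c)
    {e : E} (he : ω e = true) (hK : e ∈ G.edgesAt (G.cluster ω a)) :
    e ∉ G.edgesAt (G.cluster ω c) := by
  intro hM
  have hfst : G.fst e ∈ G.cluster ω a := by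
    rcases hK with h | h
    · exact h
    · exact G.fst_mem_cluster_of_open he h
  have hsnd : G.snd e ∈ G.cluster ω a := by
    rcases hK with h | h
    · exact G.snd_mem_cluster_of_open he h
    · exact h
  rcases hM with h | h
  · exact hac (G.mem_cluster_of_mem_inter hfst h)
  · exact hac (G.mem_cluster_of_mem_inter hsnd h)

/-- **`ab|c ⊆ BAD`** (Theorem A): with `a ~_S b` and `a ≁_S c` the cluster `K = L` is untouched by the
M-flip. -/
theorem conn_kSwap_of_conn_of_not_conn {a b c : V} {ω : Config E} (hab : G.Conn ω a b)
    (hac : ¬ G.Conn ω a c) : G.Conn (G.kSwap c ω) a b :=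
  conn_of_open_edges (fun e he hK => by
    rw [G.kSwap_apply_of_notMem (G.not_mem_edgesAt_cluster_of_open_edgesAt hac he hK)]
    exact he) hab

/-- **The split `BAD = ab|c ⊔ (BAD ∩ bot)`** on the M-flip. -/
theorem badM_iff_or (a b c : V) (ω : Config E) :
    G.BadM ω a b c ↔ (G.Conn ω a b ∧ ¬ G.Conn ω a c) ∨ G.BotM ω a b c := by
  constructor
  · rintro ⟨⟨hac, hbc⟩, hδ⟩
    by_cases hab : G.Conn ω a b
    · exact Or.inl ⟨hab, hac⟩
    · exact Or.inr ⟨⟨hab, hac, hbc⟩, hδ⟩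
  · rintro (⟨hab, hac⟩ | ⟨⟨_, hac, hbc⟩, hδ⟩)
    · exact ⟨⟨hac, fun hbc => hac (hab.trans hbc)⟩, G.conn_kSwap_of_conn_of_not_conn hab hac⟩
    · exact ⟨⟨hac, hbc⟩, hδ⟩

variable [Fintype E] [DecidableEq E]

open Classical in
/-- **THEOREM A (iii), the pairing on the M-flip**: `#{S : a ~_S b ∧ c iso in S̄} = #BadM`. -/
theorem card_conn_cIso_compl_eq_card_badM (a b c : V) :
    (Finset.univ.filter fun ω : Config E => G.Conn ω a b ∧ G.IsCIso ωᶜ a b c).card =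
      (Finset.univ.filter fun ω : Config E => G.BadM ω a b c).card := by
  let e : Config E ≃ Config E := Equiv.ofBijective (G.kSwap c) (G.kSwap_bijective c)
  symm
  refine Finset.card_nbij' (fun ω => e ω) (fun τ => e.symm τ) ?_ ?_ ?_ ?_
  · intro ω hω
    simp only [Finset.coe_filter, Finset.mem_univ, true_and, Set.mem_setOf_eq] at hω ⊢
    show G.Conn (G.kSwap c ω) a b ∧ G.IsCIso (G.kSwap c ω)ᶜ a b c
    exact ⟨hω.2, (G.isCIso_compl_kSwap_iff a b c ω).mpr hω.1⟩
  · intro τ hτ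
    simp only [Finset.coe_filter, Finset.mem_univ, true_and, Set.mem_setOf_eq] at hτ ⊢
    have hτ' : G.kSwap c (e.symm τ) = τ := e.apply_symm_apply τ
    constructor
    · rw [← G.isCIso_compl_kSwap_iff, hτ']
      exact hτ.2
    · rw [hτ']
      exact hτ.1
  · intro ω _
    exact e.symm_apply_apply ω
  · intro τ _
    exact e.apply_symm_apply τ

open Classical in
/-- `#BadM = #(ab|c) + #BotM`. -/
theorem card_badM_eq_add (a b c : V) :
    (Finset.univ.filter fun ω : Config E => G.BadM ω a b c).card =
      (Finset.univ.filter fun ω : Config E => G.Conn ω a b ∧ ¬ G.Conn ω a c).card +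
        (Finset.univ.filter fun ω : Config E => G.BotM ω a b c).card := by
  rw [← Finset.card_union_of_disjoint]
  · congr 1
    ext ω
    simp only [Finset.mem_filter, Finset.mem_univ, true_and, Finset.mem_union]
    exact G.badM_iff_or a b c ω
  · rw [Finset.disjoint_left]
    intro ω h1 h2
    simp only [Finset.mem_filter, Finset.mem_univ, true_and] at h1 h2
    exact h2.1.1 h1.1

open Classical in
/-- **`(CF) ⟺ (CF′)`**: `#BadM ≤ #OnePair` iff `#BotM ≤ #(ac|b) + #(bc|a)`. -/
theorem card_badM_le_iff (a b c : V) :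
    (Finset.univ.filter fun ω : Config E => G.BadM ω a b c).card ≤
        (Finset.univ.filter fun ω : Config E => G.OnePair ω a b c).card ↔
      (Finset.univ.filter fun ω : Config E => G.BotM ω a b c).card ≤
        (Finset.univ.filter fun ω : Config E => G.Conn ω a c ∧ ¬ G.Conn ω a b).card +
          (Finset.univ.filter fun ω : Config E => G.Conn ω b c ∧ ¬ G.Conn ω a b).card := by
  rw [G.card_badM_eq_add, G.card_onePair_eq_add]
  omega

open Classical in
/-- **The class lemma of C-026 in mine-3's residual form `(CF′)`**: the class sum of `kernel26` is
nonnegative iff `#BotM ≤ #(ac|b) + #(bc|a)`. -/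
theorem cubeSumQuad_kernel26_nonneg_iff_M (a b c : V) :
    0 ≤ G.cubeSumQuad ![a, b, c] kernel26 ↔
      (Finset.univ.filter fun ω : Config E => G.BotM ω a b c).card ≤
        (Finset.univ.filter fun ω : Config E => G.Conn ω a c ∧ ¬ G.Conn ω a b).card +
          (Finset.univ.filter fun ω : Config E => G.Conn ω b c ∧ ¬ G.Conn ω a b).card := by
  rw [G.cubeSumQuad_kernel26_eq, sub_nonneg, Nat.cast_le, G.card_conn_cIso_compl_eq_card_badM,
    G.card_badM_le_iff]

/-! ### The canonical rule C6′ -/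

/-- The pairs `(e, e')` with `e` before `e'` in the list, ordered by the LATER element first: for the
index order of the edges this is the mask order of `S + e + e'`. -/
def pairsByMaskAux {β : Type*} (acc : List β) : List β → List (β × β)
  | [] => []
  | e' :: rest => (acc.map fun e => (e, e')) ++ pairsByMaskAux (acc ++ [e']) rest

/-- The pairs of a list in the mask order (`pairsByMaskAux` from the empty prefix). -/
def pairsByMask {β : Type*} (es : List β) : List (β × β) := pairsByMaskAux [] es

open Classical in
/-- **The one-edge candidates of C6″** for the edge list `es` (the index order): the closed edges, by
index (the least free `S + e` is the one with the least mask). -/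
noncomputable def c6Cand1 (es : List E) (S : Config E) : List E :=
  es.filter fun e => decide (S e = false)

open Classical in
/-- **The two-edge candidates of C6″**: the pairs `e < e'` of closed edges, in the mask order. -/
noncomputable def c6Cand2 (es : List E) (S : Config E) : List (E × E) :=
  pairsByMask (es.filter fun e => decide (S e = false))

/-- **mine-3's request list on the M-flip** (C6″): `τ₅₀ = kSwapSealed c b → ac|b`,
`τ₁₈ = kSwapSealed c a → bc|a`, the one-edge pass, the two-edge pass. -/
noncomputable def c6Passes (es : List E) (a b c : V) : List (Config E → List (Config E)) :=
  [treePass (G.kSwapSealed c b) (fun T => G.CellAC T a b c),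
    treePass (G.kSwapSealed c a) (fun T => G.CellBC T a b c),
    G.oneEdgePassOrd (c6Cand1 es) a b c,
    G.twoEdgePassOrd (c6Cand2 es) a b c]

omit [Fintype E] in
/-- Every candidate of every pass of C6″ lies in `ac|b ⊔ bc|a`. -/
theorem cell_of_mem_c6Passes {es : List E} {a b c : V} :
    ∀ cand ∈ G.c6Passes es a b c, ∀ S T : Config E, T ∈ cand S →
      G.CellAC T a b c ∨ G.CellBC T a b c := by
  intro cand hc S T hT
  simp only [c6Passes, List.mem_cons, List.not_mem_nil, or_false] at hc
  rcases hc with rfl | rfl | rfl | rfl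
  · exact Or.inl (mem_treePass.mp hT).2
  · exact Or.inr (mem_treePass.mp hT).2
  · exact G.cell_of_mem_oneEdgePassOrd hT
  · exact G.cell_of_mem_twoEdgePassOrd hT

/-- **C6″ as a completeness statement**: for the edge list `es`, some enumeration of `BotM` is fully
served by mine-3's request list (mine-3's mask order is one witness). -/
def C6Complete (es : List E) (a b c : V) : Prop :=
  SchemeComplete (fun ω => G.BotM ω a b c) (G.c6Passes es a b c)

open Classical in
/-- **C6″ gives `(CF′)`**: the run of mine-3's request list is an injection `BotM ↪ ac|b ⊔ bc|a`. -/
theorem card_botM_le_of_c6Complete {es : List E} {a b c : V} (h : G.C6Complete es a b c) :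
    (Finset.univ.filter fun ω : Config E => G.BotM ω a b c).card ≤
      (Finset.univ.filter fun ω : Config E => G.Conn ω a c ∧ ¬ G.Conn ω a b).card +
        (Finset.univ.filter fun ω : Config E => G.Conn ω b c ∧ ¬ G.Conn ω a b).card :=
  G.card_le_of_schemeComplete _ _ G.cell_of_mem_c6Passes h

/-! ### The D-free inequality (mine-3 14:31:27Z / 14:35:24Z; the paper target of record, lead 14:33:13Z) -/

open Classical in
/-- **mine-3's D-free inequality** in the `τ`-form: `#{S ∈ bot : a ~ b in δ(S)} ≤ #{S ∈ bot : τ₅₀(S) ∈ ac|b} +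
#{S ∈ bot : τ₁₈(S) ∈ bc|a}` — by mine-3's Theorem B these are `#{bot : K ~_H L} ≤ #{bot : c ~_H K in H − L} +
#{bot : c ~_H L in H − K}`, three connectivity events of ONE bot configuration in its H-graph. -/
def DFreeIneq (a b c : V) : Prop :=
  (Finset.univ.filter fun ω : Config E => G.BotM ω a b c).card ≤
    (Finset.univ.filter fun ω : Config E =>
      G.IsBot ω a b c ∧ G.CellAC (G.kSwapSealed c b ω) a b c).card +
      (Finset.univ.filter fun ω : Config E =>
        G.IsBot ω a b c ∧ G.CellBC (G.kSwapSealed c a ω) a b c).card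

/-- An injective map into a cell bounds its domain by the cell (instance-generic). -/
theorem card_filter_le_of_injective (f : Config E → Config E) (hf : Function.Injective f)
    (P : Config E → Prop) (Q : Config E → Prop) [DecidablePred P] [DecidablePred Q]
    (h : ∀ ω, P ω → Q (f ω)) :
    (Finset.univ.filter fun ω : Config E => P ω).card ≤
      (Finset.univ.filter fun ω : Config E => Q ω).card := by
  refine Finset.card_le_card_of_injOn f ?_ ?_
  · intro ω hω
    simp only [Finset.coe_filter, Finset.mem_univ, true_and, Set.mem_setOf_eq] at hω ⊢
    exact h ω hω
  · intro ω _ ω' _ hωω'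
    exact hf hωω'

open Classical in
/-- **The D-free inequality gives `(CF′)`**: `τ₅₀` and `τ₁₈` are injective (typer-1's
`kSwapSealed_injective`), so the two right-hand terms are at most `#(ac|b)` and `#(bc|a)`. -/
theorem card_botM_le_of_dFree {a b c : V} (h : G.DFreeIneq a b c) :
    (Finset.univ.filter fun ω : Config E => G.BotM ω a b c).card ≤
      (Finset.univ.filter fun ω : Config E => G.Conn ω a c ∧ ¬ G.Conn ω a b).card +
        (Finset.univ.filter fun ω : Config E => G.Conn ω b c ∧ ¬ G.Conn ω a b).card := by
  have h1 : (Finset.univ.filter fun ω : Config E =>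
      G.IsBot ω a b c ∧ G.CellAC (G.kSwapSealed c b ω) a b c).card ≤
      (Finset.univ.filter fun ω : Config E => G.Conn ω a c ∧ ¬ G.Conn ω a b).card :=
    card_filter_le_of_injective (G.kSwapSealed c b) (G.kSwapSealed_injective c b)
      (fun ω => G.IsBot ω a b c ∧ G.CellAC (G.kSwapSealed c b ω) a b c)
      (fun ω => G.Conn ω a c ∧ ¬ G.Conn ω a b) (fun _ hω => hω.2)
  have h2 : (Finset.univ.filter fun ω : Config E =>
      G.IsBot ω a b c ∧ G.CellBC (G.kSwapSealed c a ω) a b c).card ≤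
      (Finset.univ.filter fun ω : Config E => G.Conn ω b c ∧ ¬ G.Conn ω a b).card :=
    card_filter_le_of_injective (G.kSwapSealed c a) (G.kSwapSealed_injective c a)
      (fun ω => G.IsBot ω a b c ∧ G.CellBC (G.kSwapSealed c a ω) a b c)
      (fun ω => G.Conn ω b c ∧ ¬ G.Conn ω a b) (fun _ hω => hω.2)
  unfold DFreeIneq at h
  omega

end MFlip

end MultiGraph

/-- **C6′ on the simple graphs with ≤ N vertices and three distinct marks**, for some edge list. -/
def C6CompleteSimpleUpTo (N : ℕ) : Prop :=
  ∀ {V E : Type} [Fintype V] [Fintype E] [DecidableEq E], Fintype.card V ≤ N →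
    ∀ (G : MultiGraph V E), G.IsSimple → ∀ a b c : V, a ≠ b → a ≠ c → b ≠ c →
      ∃ es : List E, G.C6Complete es a b c

/-- **C-026 on every multigraph with ≤ N vertices, at every `p`, from C6′ on the simple graphs with
≤ N vertices** — mine-3's residual claim is the only open piece. -/
theorem C026UpTo_of_c6Complete {N : ℕ} (h : C6CompleteSimpleUpTo N) : C026UpTo N := by
  refine C026UpTo_of_simpleInj ?_
  intro V E _ _ _ hV G hs m hm
  have hm' : m = ![m 0, m 1, m 2] := by
    funext i
    fin_cases i <;> rfl
  rw [hm', G.cubeSumQuad_kernel26_nonneg_iff_M]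
  obtain ⟨es, hes⟩ := h hV G hs (m 0) (m 1) (m 2) (fun h01 => absurd (hm h01) (by decide))
    (fun h02 => absurd (hm h02) (by decide)) (fun h12 => absurd (hm h12) (by decide))
  exact G.card_botM_le_of_c6Complete hes

/-- **The D-free inequality on the simple graphs with ≤ N vertices and three distinct marks.** -/
def DFreeSimpleUpTo (N : ℕ) : Prop :=
  ∀ {V E : Type} [Fintype V] [Fintype E] [DecidableEq E], Fintype.card V ≤ N →
    ∀ (G : MultiGraph V E), G.IsSimple → ∀ a b c : V, a ≠ b → a ≠ c → b ≠ c → G.DFreeIneq a b c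

/-- **C-026 on every multigraph with ≤ N vertices, at every `p`, from the D-free inequality on the simple
graphs with ≤ N vertices** — mine-3's paper target of record. -/
theorem C026UpTo_of_dFree {N : ℕ} (h : DFreeSimpleUpTo N) : C026UpTo N := by
  refine C026UpTo_of_simpleInj ?_
  intro V E _ _ _ hV G hs m hm
  have hm' : m = ![m 0, m 1, m 2] := by
    funext i
    fin_cases i <;> rfl
  rw [hm', G.cubeSumQuad_kernel26_nonneg_iff_M]
  exact G.card_botM_le_of_dFree (h hV G hs (m 0) (m 1) (m 2) (fun h01 => absurd (hm h01) (by decide))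
    (fun h02 => absurd (hm h02) (by decide)) (fun h12 => absurd (hm h12) (by decide)))

end PercRepro
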